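import Summits.CriticalPhenomena.PercolationContinuityZ3.Theorems.FK.BoxLimitJointSemicontinuity
import Summits.CriticalPhenomena.PercolationContinuityZ3.Theorems.FK.FreeWiredCoincidence
import Mathlib.Topology.Algebra.Module.Cardinality
import HarnessLib

/-!
# FK-continuity cell, FO-10a: uniqueness of the random-cluster measure is GENERIC in the parameter strip —
# `{(p,q) ∈ [0,1] × [1,∞) : φ⁰_{p,q} = φ¹_{p,q}}` is a `G_δ` of the strip and is DENSE in it

Registered R118 (cell INBOX l.7669, 2026-08-25); registry row FO-10a-g343; label STR-F (coordinator fk-4 g231).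
Cell `fk-continuity` (bschramm), row FO-10a (pressure layer); support file for the FK-continuity transplant
(`--supports stmt-CriticalPhenomena-4575`); builds on p205010 (kernel theorem, internal audit signed; external expert
review pending). Pure proofs; no definitions, no named facts, no sorries; every `d ≥ 1`. UNCONDITIONAL; it decides
nothing about FH / TP_FK / whether any PARTICULAR `(p,q)` (e.g. `(p_c(q), q)`) is a point of uniqueness.

Two tree facts combined: Thm. (4.63) (`FreeWiredCoincidence.rcLimit_false_eq_rcLimit_true_iff_of_mem_edgeSet`:
`φ⁰_{p,q} = φ¹_{p,q}` iff `h⁰(p,q)(e₀) = h¹(p,q)(e₀)`, and for each `q` the exceptional `p` form a countable set,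
`countable_setOf_rcLimit_false_ne_rcLimit_true`) and Prop. (4.28)(b),(c) in the vector `(p,q)`
(`BoxLimitJointSemicontinuity.lean`: `h¹` upper, `h⁰` lower semicontinuous jointly), so that `h¹ − h⁰ ≥ 0` is upper
semicontinuous on the strip `S = [0,1] × [1,∞)` and the uniqueness set `{h¹ − h⁰ = 0} = ⋂_n {h¹ − h⁰ < 1/(n+1)}` is a
countable intersection of relatively open sets:

* `upperSemicontinuousWithinAt_wiredEdgeDensity_sub_free` — `h¹(e₀) − h⁰(e₀)` is usc within `S`;
* **`exists_isOpen_setOf_rcLimit_eq_eq_inter_iInter`** — there are open sets `U_n ⊆ ℝ²` with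
  `{x ∈ S : φ⁰_x = φ¹_x} = S ∩ ⋂_n U_n` (the uniqueness set is a `G_δ` of the strip);
* **`subset_closure_setOf_rcLimit_eq`** — `S ⊆ closure {x ∈ S : φ⁰_x = φ¹_x}` (the uniqueness set is dense in the
  strip: on every horizontal line its complement is countable).

## References

* G. Grimmett, *The Random-Cluster Model*, Springer 2006 (`book:grimmett2006-random-cluster-model`): Prop. (4.28),
  Thm. (4.60), Thm. (4.63) [PDF pp. 79–80, 88–90]. [Grimmett2006]
-/

noncomputable section

open MeasureTheory Set Filter
open scoped Topology

namespace Summit.CriticalPhenomena.PercolationContinuityZ3.Theorems.FK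

open Literature.Probability.Percolation Literature.Probability.LatticeModels
open Literature.Barriers.CriticalPhenomena

variable {d : ℕ}

/-- **`(p,q) ↦ h¹(p,q)(e) − h⁰(p,q)(e)` is upper semicontinuous within `[0,1] × [1,∞)`** (`d ≥ 1`): `h¹` is upper and
`h⁰` lower semicontinuous in the vector `(p,q)`. [cite: Grimmett2006, Prop. (4.28)(b),(c)] -/
theorem upperSemicontinuousWithinAt_wiredEdgeDensity_sub_free (hd : 0 < d) (e : Sym2 (Site d)) {p₀ q₀ : ℝ}
    (hp₀ : p₀ ∈ Set.Icc (0 : ℝ) 1) (hq₀ : 1 ≤ q₀) :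
    UpperSemicontinuousWithinAt (fun x : ℝ × ℝ => wiredEdgeDensity d x.1 x.2 e - freeEdgeDensity d x.1 x.2 e)
      (Set.Icc (0 : ℝ) 1 ×ˢ Set.Ici (1 : ℝ)) (p₀, q₀) := by
  intro y hy
  have hy' : wiredEdgeDensity d p₀ q₀ e - freeEdgeDensity d p₀ q₀ e < y := hy
  set ε := (y - (wiredEdgeDensity d p₀ q₀ e - freeEdgeDensity d p₀ q₀ e)) / 2 with hε
  have hεpos : 0 < ε := by rw [hε]; linarith
  have h1 := upperSemicontinuousWithinAt_wiredEdgeDensity hd e hp₀ hq₀ (wiredEdgeDensity d p₀ q₀ e + ε) (by linarith)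
  have h2 := lowerSemicontinuousWithinAt_freeEdgeDensity (d := d) e hp₀ hq₀ (freeEdgeDensity d p₀ q₀ e - ε)
    (by linarith)
  filter_upwards [h1, h2] with x hx1 hx2
  have hx1' : wiredEdgeDensity d x.1 x.2 e < wiredEdgeDensity d p₀ q₀ e + ε := hx1
  have hx2' : freeEdgeDensity d p₀ q₀ e - ε < freeEdgeDensity d x.1 x.2 e := hx2
  show wiredEdgeDensity d x.1 x.2 e - freeEdgeDensity d x.1 x.2 e < y
  linarith

/-- **The uniqueness set is a `G_δ` of the parameter strip**: for `d ≥ 1` there are open sets `U_n ⊆ ℝ × ℝ` with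
`{(p,q) ∈ [0,1] × [1,∞) : φ⁰_{p,q} = φ¹_{p,q}} = ([0,1] × [1,∞)) ∩ ⋂_n U_n` — uniqueness holds iff the upper
semicontinuous nonnegative gap `h¹(e₀) − h⁰(e₀)` is `< 1/(n+1)` for every `n` (Thm. (4.63)), and each such set is
relatively open. [cite: Grimmett2006, Thm. (4.63) with Prop. (4.28)(b),(c)] -/
theorem exists_isOpen_setOf_rcLimit_eq_eq_inter_iInter (hd : 0 < d) :
    ∃ U : ℕ → Set (ℝ × ℝ), (∀ n, IsOpen (U n)) ∧
      {x : ℝ × ℝ | x ∈ Set.Icc (0 : ℝ) 1 ×ˢ Set.Ici (1 : ℝ) ∧ rcLimit d false x.1 x.2 = rcLimit d true x.1 x.2} =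
        (Set.Icc (0 : ℝ) 1 ×ˢ Set.Ici (1 : ℝ)) ∩ ⋂ n, U n := by
  set S : Set (ℝ × ℝ) := Set.Icc (0 : ℝ) 1 ×ˢ Set.Ici (1 : ℝ) with hS
  -- a reference lattice edge
  set e₀ : Sym2 (Site d) := s(0, Pi.single ⟨0, hd⟩ 1) with he₀
  have he₀E : e₀ ∈ (zdGraph d).edgeSet := by
    rw [SimpleGraph.mem_edgeSet]
    exact (zdGraph_adj_iff _ _).2 ⟨⟨0, hd⟩, Or.inl (by rw [zero_add])⟩
  set f : ℝ × ℝ → ℝ := fun x => wiredEdgeDensity d x.1 x.2 e₀ - freeEdgeDensity d x.1 x.2 e₀ with hf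
  have hmemS : ∀ {x : ℝ × ℝ}, x ∈ S → x.1 ∈ Set.Icc (0 : ℝ) 1 ∧ 1 ≤ x.2 := fun hx =>
    ⟨(Set.mem_prod.1 hx).1, Set.mem_Ici.1 (Set.mem_prod.1 hx).2⟩
  have hf0 : ∀ {x : ℝ × ℝ}, x ∈ S → 0 ≤ f x := fun hx =>
    sub_nonneg.2 (freeEdgeDensity_le_wiredEdgeDensity hd (hmemS hx).1 (hmemS hx).2 e₀)
  have hiff : ∀ {x : ℝ × ℝ}, x ∈ S → (rcLimit d false x.1 x.2 = rcLimit d true x.1 x.2 ↔ f x = 0) := by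
    intro x hx
    rw [rcLimit_false_eq_rcLimit_true_iff_of_mem_edgeSet (hmemS hx).1 (hmemS hx).2 he₀E, hf]
    constructor
    · intro h; simp only [h, sub_self]
    · intro h; linarith
  refine ⟨fun n => ⋃₀ {V : Set (ℝ × ℝ) | IsOpen V ∧ ∀ z ∈ V, z ∈ S → f z < 1 / ((n : ℝ) + 1)},
    fun n => isOpen_sUnion fun V hV => hV.1, ?_⟩
  ext x
  simp only [Set.mem_setOf_eq, Set.mem_inter_iff, Set.mem_iInter, Set.mem_sUnion]
  constructor
  · rintro ⟨hxS, heq⟩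
    refine ⟨hxS, fun n => ?_⟩
    have hfx : f x = 0 := (hiff hxS).1 heq
    have hpos : f x < 1 / ((n : ℝ) + 1) := by rw [hfx]; positivity
    have husc := upperSemicontinuousWithinAt_wiredEdgeDensity_sub_free hd e₀ (hmemS hxS).1 (hmemS hxS).2
    have hev : ∀ᶠ z in 𝓝[S] (x.1, x.2), f z < 1 / ((n : ℝ) + 1) := husc _ hpos
    rw [Prod.mk.eta, eventually_nhdsWithin_iff, eventually_nhds_iff] at hev
    obtain ⟨V, hV, hVo, hxV⟩ := hev
    exact ⟨V, ⟨hVo, fun z hz hzS => hV z hz hzS⟩, hxV⟩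
  · rintro ⟨hxS, hU⟩
    refine ⟨hxS, (hiff hxS).2 (le_antisymm ?_ (hf0 hxS))⟩
    by_contra hlt
    push Not at hlt
    obtain ⟨n, hn⟩ := exists_nat_one_div_lt hlt
    obtain ⟨V, ⟨-, hV⟩, hxV⟩ := hU n
    exact (lt_irrefl _) ((hV x hxV hxS).trans hn)

/-- **The uniqueness set is dense in the parameter strip**: every `(p,q) ∈ [0,1] × [1,∞)` is a limit of points
`(p',q)` of the same strip with `φ⁰_{p',q} = φ¹_{p',q}` — for fixed `q` the exceptional `p'` form a countable set
(Thm. (4.60)/(4.63)), whose complement is dense in `ℝ`. [cite: Grimmett2006, Thm. (4.60), Thm. (4.63)] -/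
theorem subset_closure_setOf_rcLimit_eq :
    (Set.Icc (0 : ℝ) 1 ×ˢ Set.Ici (1 : ℝ) : Set (ℝ × ℝ)) ⊆
      closure {x : ℝ × ℝ | x ∈ Set.Icc (0 : ℝ) 1 ×ˢ Set.Ici (1 : ℝ) ∧ rcLimit d false x.1 x.2 = rcLimit d true x.1 x.2} := by
  rintro ⟨p, q⟩ hx
  obtain ⟨hp, hq⟩ : p ∈ Set.Icc (0 : ℝ) 1 ∧ 1 ≤ q := ⟨(Set.mem_prod.1 hx).1, Set.mem_Ici.1 (Set.mem_prod.1 hx).2⟩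
  rw [Metric.mem_closure_iff]
  intro ε hε
  -- the countable exceptional set on the line `q`, and its dense complement
  have hC := countable_setOf_rcLimit_false_ne_rcLimit_true (d := d) hq
  have hdense := Set.Countable.dense_compl ℝ hC
  -- a nonempty open interval of admissible `p'` within `ε` of `p`
  have hlt : max 0 (p - ε) < min 1 (p + ε) :=
    max_lt (lt_min one_pos (by linarith [hp.1])) (lt_min (by linarith [hp.2]) (by linarith))
  obtain ⟨p', hp'C, hp'I⟩ := hdense.exists_mem_open isOpen_Ioo (Set.nonempty_Ioo.2 hlt)
  have hp'01 : p' ∈ Set.Icc (0 : ℝ) 1 :=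
    ⟨(le_max_left _ _).trans hp'I.1.le, (hp'I.2.trans_le (min_le_left _ _)).le⟩
  have hp'eq : rcLimit d false p' q = rcLimit d true p' q := by
    by_contra hne
    exact hp'C ⟨hp'01, hne⟩
  refine ⟨(p', q), ⟨Set.mk_mem_prod hp'01 (Set.mem_Ici.2 hq), hp'eq⟩, ?_⟩
  rw [Prod.dist_eq, dist_self, max_eq_left dist_nonneg, Real.dist_eq, abs_sub_lt_iff]
  constructor
  · linarith [(le_max_right _ _).trans_lt hp'I.1]
  · linarith [hp'I.2.trans_le (min_le_right _ _)]

end Summit.CriticalPhenomena.PercolationContinuityZ3.Theorems.FK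

end
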